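import Mathlib
import Literature.NumberTheory.LFunctions.Zhang2022.Section4Statements
import Literature.NumberTheory.LFunctions.Zhang2022.Section4FELine
import HarnessLib

/-!
# Zhang (2022) §4, Lemma 4.4: the line `Re w = 1` of the smoothed Perron integral is the tree's
# Mellin identity — `(2πi)⁻¹∫_{(1)} L(s+w,ψ)L(s+w,ψχ)P^{(9/5)w}ω₁(w)dw/w = Σₙ ν(n)ψ(n)n^{−s}g(P^{9/5}/n)`

Topic `Literature/NumberTheory/LFunctions/Zhang2022` (Landau–Siegel adjudication tree;
verdict-neutral). Y. Zhang, *Discrete mean estimates and the Landau–Siegel zero*,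
arXiv:2211.02515v1 (2022) [Zhang2022LandauSiegel] — **an unrefereed manuscript under adjudication**
— §4, proof of Lemma 4.4, p. 19 (tex L1053–L1061; DAG `Z22:§4.u026`):

> By (4.2) and (4.3),
> `(2πi)⁻¹∫_{(1)} L(s+w,ψ)L(s+w,ψχ)P^{(9/5)w} ω₁(w)dw/w = F(s,ψ) + Σ_{D⁴<n<P²} ν(n)ψ(n)n^{−s}g(P^{9/5}/n) + O(ε)`
> where `ε = exp{−c𝓛¹⁰}`.

The EXACT content of this display is the termwise Mellin evaluation of the absolutely convergent
Dirichlet series `L(s+w,ψ)L(s+w,ψχ) = Σₙ ν(n)ψ(n)n^{−s−w}` (`Re(s+w) = σ + 1 > 1`) against the kernel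
`P^{(9/5)w}ω₁(w)/w`, which the tree proves in general (`GaussWeight.integral_LSeries_mul_kernel`,
`Section4GaussianWeight`). This file (theorems only; no definition, no new named fact) instantiates
it for the campaign's typed objects (`Section4.perronLine`, `Section4.perronIntegrand`,
`Section4.omega1W`, `Skeleton.LL`, `Skeleton.gW` of `Section4Statements` / `SkeletonPartOneB`):

* `Section4.convolution_psi_psiChi`, `Section4.LL_eq_LSeries` — **`L(z,ψ)L(z,ψχ) = Σₙ ν(n)ψ(n)n^{−z}`
  for `Re z > 1`** (`ψ ∗ ψχ = νψ`, Mathlib's `LSeries_convolution'`; the value `(ψχ)(n) = χ(n)ψ(n)` is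
  `Section4.psiChi_apply_natCast` of `Section4FELine`), and `Section4.LSeriesSummable_nu_psi`;
* `Section4.perronIntegrand_lineOne` — on `Re w = 1` the Perron integrand IS the tree's
  `LSeries · kernel` (`(P:ℂ)^{(9/5)w} = (P^{9/5})^{w}`);
* `Section4.perronLine_one_eq_tsum` — **`(2πi)⁻¹∫_{(1)} … = Σ'ₙ ν(n)ψ(n)n^{−s}g(P^{9/5}/n)`** for
  every `ψ ∈ Ψ` and every `s` with `Re s > 0` (so on `Ω₃`).

The `O(ε)` bookkeeping (head `n ≤ D⁴` via (4.2), tail `n ≥ P²` via (4.3)) that turns this into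
the typed node `Section4.LineOneEval` is the sibling file `Section4LineOneEval.lean`. Nothing about
Theorems 1–2 of the source or about Landau–Siegel zeros is stated or implied.

## References

* Y. Zhang, arXiv:2211.02515v1 (2022), §4 p. 19 (proof of Lemma 4.4, first two displays); (4.1).
  [cite: Zhang2022LandauSiegel, §4 Lemma 4.4 (proof) p. 19]
* Mathlib, `LSeries_convolution'`, `DirichletCharacter.LFunction_eq_LSeries`.
-/

noncomputable section

open Complex Real MeasureTheory
open scoped LSeries.notation

namespace Literature.NumberTheory.LFunctions.Zhang2022.Section4

open Skeleton
open LSeries (term term_of_ne_zero)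

section WithCharacter

variable {D : ℕ} (χ : DirichletCharacter ℂ D) (x : Chr D)

/-- **`ψ ∗ ψχ = νψ`**: the Dirichlet convolution of `n ↦ ψ(n)` and `n ↦ (ψχ)(n)` is
`n ↦ ν(n)ψ(n)`, `ν(n) = Σ_{d∣n} χ(d)`. [cite: Zhang2022LandauSiegel, §4 Lemma 4.4 (proof) p. 19] -/
theorem convolution_psi_psiChi (n : ℕ) :
    ((fun m : ℕ => x.ψ (m : ZMod x.p)) ⍟ (fun m : ℕ => psiChi χ x (m : ZMod (D * x.p)))) n
      = nu χ n * x.ψ (n : ZMod x.p) := by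
  rw [LSeries.convolution_def]
  simp only [psiChi_apply_natCast χ x]
  have key : ∀ p ∈ n.divisorsAntidiagonal,
      x.ψ (p.1 : ZMod x.p) * (χ (p.2 : ZMod D) * x.ψ (p.2 : ZMod x.p))
        = χ (p.2 : ZMod D) * x.ψ (n : ZMod x.p) := by
    intro p hp
    have h := (Nat.mem_divisorsAntidiagonal.mp hp).1
    rw [← h, Nat.cast_mul, map_mul]
    ring
  rw [Finset.sum_congr rfl key, ← Finset.sum_mul]
  congr 1
  rw [nu, Literature.NumberTheory.LFunctions.divisorSumChar_apply]
  exact Nat.sum_divisorsAntidiagonal' (f := fun _ b => χ (b : ZMod D))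

/-- **`L(z,ψ)L(z,ψχ) = Σₙ ν(n)ψ(n)n^{−z}`** for `Re z > 1` (product of the two Dirichlet series =
Dirichlet series of the convolution `νψ`). [cite: Zhang2022LandauSiegel, §4 Lemma 4.4 (proof) p. 19] -/
theorem LL_eq_LSeries [NeZero D] {z : ℂ} (hz : 1 < z.re) :
    LL χ x z = LSeries (fun n => nu χ n * x.ψ (n : ZMod x.p)) z := by
  rw [LL, DirichletCharacter.LFunction_eq_LSeries _ hz,
    DirichletCharacter.LFunction_eq_LSeries _ hz,
    ← LSeries_convolution' (DirichletCharacter.LSeriesSummable_of_one_lt_re _ hz)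
      (DirichletCharacter.LSeriesSummable_of_one_lt_re _ hz)]
  exact LSeries_congr (fun {n} _ => convolution_psi_psiChi χ x n) z

/-- The Dirichlet series `Σ ν(n)ψ(n)n^{−z}` converges absolutely for `Re z > 1`.
[cite: Zhang2022LandauSiegel, §4 Lemma 4.4 (proof) p. 19] -/
theorem LSeriesSummable_nu_psi [NeZero D] {z : ℂ} (hz : 1 < z.re) :
    LSeriesSummable (fun n => nu χ n * x.ψ (n : ZMod x.p)) z := by
  have h := (DirichletCharacter.LSeriesSummable_of_one_lt_re x.ψ hz).convolution
    (DirichletCharacter.LSeriesSummable_of_one_lt_re (psiChi χ x) hz)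
  exact (LSeriesSummable_congr z (fun {n} _ => convolution_psi_psiChi χ x n)).mp h

/-- `P^{(9/5)w} = (P^{9/5})^{w}` (real positive base). [cite: Zhang2022LandauSiegel, §4 Lemma 4.4 (proof) p. 19] -/
theorem bigP_cpow_mul_eq (D : ℕ) (w : ℂ) :
    (bigP D : ℂ) ^ ((9 / 5 : ℂ) * w) = ((bigP D ^ (9 / 5 : ℝ) : ℝ) : ℂ) ^ w := by
  have hP : 0 < bigP D := Real.exp_pos _
  rw [GaussWeight.cpow_eq_exp_log hP, GaussWeight.cpow_eq_exp_log (Real.rpow_pos_of_pos hP _),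
    Real.log_rpow hP]
  congr 1
  push_cast
  ring

/-- **On the line `Re w = 1` the smoothed Perron integrand is the tree's Mellin integrand**:
`L(s+w,ψ)L(s+w,ψχ)·P^{(9/5)w}ω₁(w)/w = (Σₙ ν(n)ψ(n)n^{−(s+w)})·K_{P^{9/5}}(v)`, `w = 1 + iv`
(`Re s > 0`; `K` = `GaussWeight.kernel 𝓛³⁰ 1 P^{9/5}`). [cite: Zhang2022LandauSiegel, §4 Lemma 4.4 (proof) p. 19] -/
theorem perronIntegrand_lineOne [NeZero D] {s : ℂ} (hs : 0 < s.re) (v : ℝ) :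
    perronIntegrand D (fun w => LL χ x (s + w)) (((1 : ℝ) : ℂ) + v * I)
      = LSeries (fun n => nu χ n * x.ψ (n : ZMod x.p)) (s + (((1 : ℝ) : ℂ) + v * I))
        * GaussWeight.kernel (ell D ^ 30) 1 (bigP D ^ (9 / 5 : ℝ)) v := by
  have hre : 1 < (s + (((1 : ℝ) : ℂ) + v * I)).re := by simp; linarith
  rw [perronIntegrand, LL_eq_LSeries χ x hre, bigP_cpow_mul_eq, GaussWeight.kernel, omega1W]
  ring

/-- **`Z22:§4.u026`, exact part**: for every `ψ ∈ Ψ` and `s` with `Re s > 0`,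
`(2πi)⁻¹∫_{(1)} L(s+w,ψ)L(s+w,ψχ)P^{(9/5)w}ω₁(w)dw/w = Σ'ₙ ν(n)ψ(n)n^{−s}g(P^{9/5}/n)` — the tree's
Mellin identity `GaussWeight.integral_LSeries_mul_kernel` (interchange of `Σ` and `∫` by absolute
convergence on `Re(s+w) = σ + 1 > 1`) for the typed `Section4.perronLine`.
[cite: Zhang2022LandauSiegel, §4 Lemma 4.4 (proof) p. 19] -/
theorem perronLine_one_eq_tsum [NeZero D] {s : ℂ} (hs : 0 < s.re) (hℓ : 0 < ell D) :
    perronLine D (fun w => LL χ x (s + w)) 1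
      = ∑' n : ℕ, term (fun n => nu χ n * x.ψ (n : ZMod x.p)) s n
          * (gW D (bigP D ^ (9 / 5 : ℝ) / (n : ℝ)) : ℂ) := by
  have hP : 0 < bigP D := Real.exp_pos _
  have hX : 0 < bigP D ^ (9 / 5 : ℝ) := Real.rpow_pos_of_pos hP _
  have hΛ : 0 < ell D ^ 30 := by positivity
  have hsum : LSeriesSummable (fun n => nu χ n * x.ψ (n : ZMod x.p)) (s + ((1 : ℝ) : ℂ)) := by
    refine LSeriesSummable_nu_psi χ x ?_
    simp; linarith
  rw [perronLine]
  simp_rw [perronIntegrand_lineOne χ x hs]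
  rw [GaussWeight.integral_LSeries_mul_kernel hΛ one_pos hX hsum]
  rfl

end WithCharacter

end Literature.NumberTheory.LFunctions.Zhang2022.Section4

end
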